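import Summits.CriticalPhenomena.PercolationContinuityZ3.Theorems.PercNearOneGluingNoHeavyLowerTailSahiTransportJR3Measure

/-!
# `NoHeavyLowerTail` (crux stmt-CriticalPhenomena-4575), Sahi / Kahn positivity: three-sample parameter-free certificates — SOUNDNESS (rows)

Support file (cell `prim-l12`, seat P3, gen 5; `--supports stmt-CriticalPhenomena-4575`).  No `sorry`, no named facts, standard axioms.
The three-sample analogue of `…SahiTransportJRRows`: `aZ3`/`tcZ3` are the `cubicZ` of explicit signed families of cubic bitmask terms indexed by
`Fin 8 ⊕ (Fin 2^m × Fin 2^m × Fin 2^m)` (third table the point mask `2^ξ`), coefficient budgets `≤ BND3 m`, and the row inequalities from a passing digit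
test (`capacity3_of_rowOK`, `tc3_of_rowOK`). [this work]
-/

noncomputable section

open scoped Classical

namespace Summit.CriticalPhenomena.PercolationContinuityZ3.Theorems.SahiTransportJR

open Finset SahiHittingSlot SahiTransportCert SahiC3Cube SahiTransportCheck OneCutCert CovTransferCert Literature.Combinatorics.Sahi2008
open Literature.Probability.Percolation (DeterminedBy)
open Literature.Probability.Percolation.BHK2006 (weight ind_inter)
open Literature.Probability.Percolation.DecisionTree (ind ind_of_mem ind_of_not_mem ind_nonneg)

variable {m : ℕ}


/-- The cache of triple singleton products. [this work] -/
theorem get3_prodTab3 (σ : ℕ) {η ζ ξ : ℕ} (hη : η < 2 ^ m) (hζ : ζ < 2 ^ m) (hξ : ξ < 2 ^ m) :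
    get3 (prodTab3 σ m) η ζ ξ = (krT σ m (2 ^ η) : ℤ) * (krT σ m (2 ^ ζ) : ℤ) * (krT σ m (2 ^ ξ) : ℤ) := by
  unfold get3 prodTab3
  simp only [List.getD_eq_getElem?_getD, List.getElem?_map, List.getElem?_range hη, List.getElem?_range hζ, List.getElem?_range hξ,
    Option.map_some, Option.getD_some]

/-- `rhoZ3` with the true cache, as an indicator triple sum. [this work] -/
theorem rhoZ3_eq (σ M : ℕ) (ct : Tab3) (K : ℕ) :
    rhoZ3 m M ct (prodTab3 σ m) K = ∑ η ∈ Finset.range (2 ^ m), ∑ ζ ∈ Finset.range (2 ^ m), ∑ ξ ∈ Finset.range (2 ^ m),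
      if M.testBit η = false ∧ M.testBit ζ = true then
        massK3 m M ct K η ζ ξ * ((krT σ m (2 ^ η) : ℤ) * (krT σ m (2 ^ ζ) : ℤ) * (krT σ m (2 ^ ξ) : ℤ)) else 0 := by
  unfold rhoZ3
  rw [sum_pts]
  refine Finset.sum_congr rfl fun η hη => ?_
  have hη' := Finset.mem_range.1 hη
  rw [testBit_cpl hη']
  by_cases hD : M.testBit η = false
  · rw [if_pos (by rw [hD]; rfl), sum_pts]
    refine Finset.sum_congr rfl fun ζ hζ => ?_
    by_cases hH : M.testBit ζ = true
    · rw [if_pos hH, sum_map_range]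
      refine Finset.sum_congr rfl fun ξ hξ => ?_
      rw [if_pos ⟨hD, hH⟩, get3_prodTab3 σ hη' (Finset.mem_range.1 hζ) (Finset.mem_range.1 hξ)]
    · rw [if_neg hH]; symm; exact Finset.sum_eq_zero fun ξ _ => if_neg (fun h => hH h.2)
  · have hD' : M.testBit η = true := by cases hb : M.testBit η <;> simp_all
    rw [if_neg (by rw [hD']; decide)]
    symm; exact Finset.sum_eq_zero fun ζ _ => Finset.sum_eq_zero fun ξ _ => if_neg (fun h => hD h.1)

/-- Index type of the three-sample rows with `n` head terms. [this work] -/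
abbrev J3 (n m : ℕ) := Fin n ⊕ (Fin (2 ^ m) × (Fin (2 ^ m) × Fin (2 ^ m)))

/-- The `(η, ζ, ξ)` part of a certificate number. [this work] -/
theorem inr_sum_eq3 (σ M : ℕ) (ct : Tab3) (K : ℕ) :
    (∑ η : Fin (2 ^ m), ∑ ζ : Fin (2 ^ m), ∑ ξ : Fin (2 ^ m),
      (if M.testBit (η : ℕ) = false ∧ M.testBit (ζ : ℕ) = true then -massK3 m M ct K η ζ ξ else 0) *
        ((krT σ m (2 ^ (η : ℕ)) : ℤ) * (krT σ m (2 ^ (ζ : ℕ)) : ℤ) * (krT σ m (2 ^ (ξ : ℕ)) : ℤ))) = -rhoZ3 m M ct (prodTab3 σ m) K := by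
  rw [rhoZ3_eq, ← Finset.sum_neg_distrib]
  rw [Fin.sum_univ_eq_sum_range (fun η => ∑ ζ : Fin (2 ^ m), ∑ ξ : Fin (2 ^ m),
      (if M.testBit η = false ∧ M.testBit (ζ : ℕ) = true then -massK3 m M ct K η ζ ξ else 0) *
        ((krT σ m (2 ^ η) : ℤ) * (krT σ m (2 ^ (ζ : ℕ)) : ℤ) * (krT σ m (2 ^ (ξ : ℕ)) : ℤ))) (2 ^ m)]
  refine Finset.sum_congr rfl fun η _ => ?_
  rw [← Finset.sum_neg_distrib, Fin.sum_univ_eq_sum_range (fun ζ => ∑ ξ : Fin (2 ^ m),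
      (if M.testBit η = false ∧ M.testBit ζ = true then -massK3 m M ct K η ζ ξ else 0) *
        ((krT σ m (2 ^ η) : ℤ) * (krT σ m (2 ^ ζ) : ℤ) * (krT σ m (2 ^ (ξ : ℕ)) : ℤ))) (2 ^ m)]
  refine Finset.sum_congr rfl fun ζ _ => ?_
  rw [← Finset.sum_neg_distrib, Fin.sum_univ_eq_sum_range (fun ξ =>
      (if M.testBit η = false ∧ M.testBit ζ = true then -massK3 m M ct K η ζ ξ else 0) *
        ((krT σ m (2 ^ η) : ℤ) * (krT σ m (2 ^ ζ) : ℤ) * (krT σ m (2 ^ ξ) : ℤ))) (2 ^ m)]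
  refine Finset.sum_congr rfl fun ξ _ => ?_
  split_ifs <;> ring

/-- The coefficient budget of the `(η, ζ, ξ)` part. [this work] -/
theorem inr_abs_le3 {M : ℕ} {ct : Tab3} (hf : TabFacts3 m M ct) (K : ℕ) :
    (∑ η : Fin (2 ^ m), ∑ ζ : Fin (2 ^ m), ∑ ξ : Fin (2 ^ m),
      |(if M.testBit (η : ℕ) = false ∧ M.testBit (ζ : ℕ) = true then -massK3 m M ct K η ζ ξ else 0 : ℤ)|) ≤ 2 ^ m * (2 ^ m * (2 ^ m * DEN)) := by
  have h1 : ∀ η ζ ξ : Fin (2 ^ m), |(if M.testBit (η : ℕ) = false ∧ M.testBit (ζ : ℕ) = true then -massK3 m M ct K η ζ ξ else 0 : ℤ)| ≤ DEN := by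
    intro η ζ ξ
    split_ifs with hc
    · rw [abs_neg]
      have hb := massK3_bounds hf K η.2 hc.1 ζ.2 hc.2 ξ.2
      rw [abs_of_nonneg hb.1]; exact hb.2
    · simp [DEN]
  calc (∑ η : Fin (2 ^ m), ∑ ζ : Fin (2 ^ m), ∑ ξ : Fin (2 ^ m), |(if M.testBit (η : ℕ) = false ∧ M.testBit (ζ : ℕ) = true then -massK3 m M ct K η ζ ξ else 0 : ℤ)|)
      ≤ ∑ η : Fin (2 ^ m), ∑ ζ : Fin (2 ^ m), ∑ ξ : Fin (2 ^ m), (DEN : ℤ) :=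
        Finset.sum_le_sum fun η _ => Finset.sum_le_sum fun ζ _ => Finset.sum_le_sum fun ξ _ => h1 η ζ ξ
    _ = 2 ^ m * (2 ^ m * (2 ^ m * DEN)) := by simp

/-! #### Capacity rows -/

/-- Signs/coefficients of a three-sample capacity row. [this work] -/
def sA3 (m M : ℕ) (ct : Tab3) (t : ℕ) : J3 2 m → ℤ
  | Sum.inl _ => DEN
  | Sum.inr p => if M.testBit p.1 = false ∧ M.testBit p.2.1 = true then -massK3 m M ct (2 ^ t) p.1 p.2.1 p.2.2 else 0

/-- First tables. [this work] -/
def b1 (m M : ℕ) : J3 2 m → ℕ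
  | Sum.inl j => if j = 0 then fullN m else cpl m M
  | Sum.inr p => 2 ^ (p.1 : ℕ)

/-- Second tables. [this work] -/
def b2 (m : ℕ) : J3 2 m → ℕ
  | Sum.inl _ => fullN m
  | Sum.inr p => 2 ^ (p.2.1 : ℕ)

/-- Third tables. [this work] -/
def b3 (m t : ℕ) : J3 2 m → ℕ
  | Sum.inl _ => 2 ^ t
  | Sum.inr p => 2 ^ (p.2.2 : ℕ)

/-- The certificate number of a three-sample capacity row is the `cubicZ` of its term family. [this work] -/
theorem aZ3_eq_cubicZ (σ M : ℕ) (ct : Tab3) (t : ℕ) :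
    aZ3 σ m M ct (prodTab3 σ m) (krT σ m (fullN m)) (krT σ m (cpl m M)) t =
      cubicZ (2 ^ σ) (sA3 m M ct t) (fun j => tabZ m (b1 m M j)) (fun j => tabZ m (b2 m j)) (fun j => tabZ m (b3 m t j)) := by
  unfold aZ3 cubicZ
  rw [Fintype.sum_sum_type, Fin.sum_univ_two, Fintype.sum_prod_type]
  simp only [Fintype.sum_prod_type, sA3, b1, b2, b3, if_true, show (1 : Fin 2) ≠ 0 from by decide, if_false, ← krT_eq]
  rw [inr_sum_eq3]
  ring

/-- The coefficient budget of a three-sample capacity row. [this work] -/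
theorem abs_sA3_le {M : ℕ} {ct : Tab3} (hf : TabFacts3 m M ct) (t : ℕ) : (∑ j, |sA3 m M ct t j|) ≤ (BND3 m : ℤ) := by
  rw [Fintype.sum_sum_type, Fin.sum_univ_two, Fintype.sum_prod_type]
  simp only [Fintype.sum_prod_type]
  have h2 := inr_abs_le3 hf (2 ^ t)
  simp only [sA3, abs_of_nonneg (show (0 : ℤ) ≤ DEN from by simp [DEN])]
  have h4 : (8 : ℤ) ^ m = 2 ^ m * (2 ^ m * 2 ^ m) := by rw [← mul_pow, ← mul_pow]; norm_num
  have h5 : (BND3 m : ℤ) = DEN * (8 + 2 ^ m * (2 ^ m * 2 ^ m)) := by unfold BND3; push_cast; rw [h4]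
  rw [h5]
  nlinarith [h2, show (0 : ℤ) ≤ DEN from by simp [DEN], show (0:ℤ) ≤ 2 ^ m * (2 ^ m * 2 ^ m) from by positivity]

/-- `DEN·σ(T)` as a triple sum over `Fin`. [this work] -/
theorem DEN_mul_sg3 (M : ℕ) (ct : Tab3) (q : Fin m → unitInterval) (T : Set (Fin m)) :
    (DEN : ℝ) * sg3 m M ct q T = ∑ η : Fin (2 ^ m), ∑ ζ : Fin (2 ^ m), ∑ ξ : Fin (2 ^ m),
      if M.testBit (η : ℕ) = false ∧ M.testBit (ζ : ℕ) = true then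
        (get4 ct η ζ ξ (code T) : ℝ) * (mlM m (2 ^ (η : ℕ)) (xq q) * mlM m (2 ^ (ζ : ℕ)) (xq q) * mlM m (2 ^ (ξ : ℕ)) (xq q)) else 0 := by
  unfold sg3
  rw [mul_div_cancel₀ _ DEN_pos.ne']
  rw [Fin.sum_univ_eq_sum_range (fun η => ∑ ζ : Fin (2 ^ m), ∑ ξ : Fin (2 ^ m),
      if M.testBit η = false ∧ M.testBit (ζ : ℕ) = true then
        (get4 ct η ζ ξ (code T) : ℝ) * (mlM m (2 ^ η) (xq q) * mlM m (2 ^ (ζ : ℕ)) (xq q) * mlM m (2 ^ (ξ : ℕ)) (xq q)) else 0) (2 ^ m)]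
  refine Finset.sum_congr rfl fun η _ => ?_
  rw [Fin.sum_univ_eq_sum_range (fun ζ => ∑ ξ : Fin (2 ^ m), if M.testBit η = false ∧ M.testBit ζ = true then
        (get4 ct η ζ ξ (code T) : ℝ) * (mlM m (2 ^ η) (xq q) * mlM m (2 ^ ζ) (xq q) * mlM m (2 ^ (ξ : ℕ)) (xq q)) else 0) (2 ^ m)]
  refine Finset.sum_congr rfl fun ζ _ => ?_
  exact (Fin.sum_univ_eq_sum_range (fun ξ => if M.testBit η = false ∧ M.testBit ζ = true then
        (get4 ct η ζ ξ (code T) : ℝ) * (mlM m (2 ^ η) (xq q) * mlM m (2 ^ ζ) (xq q) * mlM m (2 ^ ξ) (xq q)) else 0) (2 ^ m)).symm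

/-- **Three-sample capacity rows are sound.** [this work] -/
theorem capacity3_of_rowOK {σ M : ℕ} {ct : Tab3} {P : Set (Set (Fin m))} (hPM : ∀ x, x < 2 ^ m → (M.testBit x = true ↔ pt m x ∈ P))
    (hf : TabFacts3 m M ct) (hσ : 0 < σ) (hbnd : BND3 m * 8 ^ m < 2 ^ (σ - 1)) (q : Fin m → unitInterval) (T : Set (Fin m))
    (hrow : rowOK (offT σ m) (offT σ m).toNat (aZ3 σ m M ct (prodTab3 σ m) (krT σ m (fullN m)) (krT σ m (cpl m M)) (code T)) = true) :
    sg3 m M ct q T ≤ (2 - pr q P) * bernoulliWeight q T := by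
  rw [aZ3_eq_cubicZ] at hrow
  have hB : (∑ j, |sA3 m M ct (code T) j|) * 8 ^ m < 2 ^ (σ - 1) := by
    have h1 := abs_sA3_le hf (code T)
    have h2 : (BND3 m : ℤ) * 8 ^ m < 2 ^ (σ - 1) := by exact_mod_cast hbnd
    nlinarith [h1, show (0:ℤ) < 8 ^ m from by positivity]
  have hF := cubicForm_nonneg_of_rowOK (sA3 m M ct (code T)) (b1 m M) (b2 m) (b3 m (code T)) hσ hB hrow (inCube_xq q)
  unfold cubicForm at hF
  rw [Fintype.sum_sum_type, Fin.sum_univ_two, Fintype.sum_prod_type] at hF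
  simp only [Fintype.sum_prod_type, sA3, b1, b2, b3, if_true, show (1 : Fin 2) ≠ 0 from by decide, if_false] at hF
  have hML : ∀ T' : ℕ, ML (fun g => ((tabZ m T' g : ℤ) : ℝ)) (xq q) = mlM m T' (xq q) := fun T' => rfl
  simp only [hML, show mlM m (fullN m) (xq q) = 1 from ML_fullN m (xq q)] at hF
  have hw : mlM m (2 ^ code T) (xq q) = bernoulliWeight q T := by
    rw [← bernoulliWeight_pt_eq_mlM q (code_lt T), pt_code]
  have hD : mlM m (cpl m M) (xq q) = pr q Pᶜ := by
    rw [pr_eq_mlM]; exact (mlM_congr (tabR_encA_eq (cpl_spec hPM)) _).symm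
  have hθ : 2 - pr q P = 1 + pr q Pᶜ := by rw [pr_compl]; ring
  have hsg : (∑ η : Fin (2 ^ m), ∑ ζ : Fin (2 ^ m), ∑ ξ : Fin (2 ^ m),
      ((if M.testBit (η : ℕ) = false ∧ M.testBit (ζ : ℕ) = true then -massK3 m M ct (2 ^ code T) η ζ ξ else 0 : ℤ) : ℝ) *
        (mlM m (2 ^ (η : ℕ)) (xq q) * mlM m (2 ^ (ζ : ℕ)) (xq q) * mlM m (2 ^ (ξ : ℕ)) (xq q))) = -((DEN : ℝ) * sg3 m M ct q T) := by
    rw [DEN_mul_sg3, ← Finset.sum_neg_distrib]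
    refine Finset.sum_congr rfl fun η _ => ?_
    rw [← Finset.sum_neg_distrib]
    refine Finset.sum_congr rfl fun ζ _ => ?_
    rw [← Finset.sum_neg_distrib]
    refine Finset.sum_congr rfl fun ξ _ => ?_
    split_ifs with hc
    · rw [massK3_pow hf (code_lt T) η.2 hc.1 ζ.2 hc.2 ξ.2]; push_cast; ring
    · simp
  rw [hsg, hw, hD] at hF
  simp only [Int.cast_natCast] at hF
  rw [hθ]
  have hDEN := DEN_pos
  have hkey : (DEN : ℝ) * sg3 m M ct q T ≤ (DEN : ℝ) * ((1 + pr q Pᶜ) * bernoulliWeight q T) := by nlinarith [hF]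
  exact le_of_mul_le_mul_left hkey hDEN

/-! #### Transport rows (TC) -/

/-- Signs/coefficients of a three-sample (TC) row. [this work] -/
def sT3 (m M : ℕ) (ct : Tab3) (K : ℕ) : J3 8 m → ℤ
  | Sum.inl j => ![(DEN : ℤ), DEN, -DEN, -DEN, -DEN, -DEN, DEN, DEN] j
  | Sum.inr p => if M.testBit p.1 = false ∧ M.testBit p.2.1 = true then -massK3 m M ct K p.1 p.2.1 p.2.2 else 0

/-- First tables of a three-sample (TC) row. [this work] -/
def v1 (m M X Z : ℕ) : J3 8 m → ℕ
  | Sum.inl j => ![fullN m, cpl m M, fullN m, cpl m M, fullN m, cpl m M, X, Z] j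
  | Sum.inr p => 2 ^ (p.1 : ℕ)

/-- Second tables. [this work] -/
def v2 (m M X Z : ℕ) : J3 8 m → ℕ
  | Sum.inl j => ![fullN m, fullN m, X, X, fullN m, fullN m, cpl m M &&& Z, cpl m M &&& X] j
  | Sum.inr p => 2 ^ (p.2.1 : ℕ)

/-- Third tables. [this work] -/
def v3 (m M X Z : ℕ) : J3 8 m → ℕ
  | Sum.inl j => ![X &&& Z, X &&& Z, Z, Z, cpl m M &&& (X &&& Z), cpl m M &&& (X &&& Z), fullN m, fullN m] j
  | Sum.inr p => 2 ^ (p.2.2 : ℕ)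

/-- The certificate number of a three-sample (TC) row is the `cubicZ` of its term family. [this work] -/
theorem tcZ3_eq_cubicZ (σ M : ℕ) (ct : Tab3) (X Z : ℕ) :
    tcZ3 σ m M ct (prodTab3 σ m) (krT σ m (fullN m)) (krT σ m (cpl m M)) X Z =
      cubicZ (2 ^ σ) (sT3 m M ct (X &&& Z)) (fun j => tabZ m (v1 m M X Z j)) (fun j => tabZ m (v2 m M X Z j))
        (fun j => tabZ m (v3 m M X Z j)) := by
  unfold tcZ3 cubicZ
  rw [Fintype.sum_sum_type, Fintype.sum_prod_type]
  simp only [Fintype.sum_prod_type, sT3, v1, v2, v3, Fin.sum_univ_eight, Matrix.cons_val_zero, Matrix.cons_val_one, Matrix.cons_val, ← krT_eq]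
  rw [inr_sum_eq3]
  ring

/-- The coefficient budget of a three-sample (TC) row. [this work] -/
theorem abs_sT3_le {M : ℕ} {ct : Tab3} (hf : TabFacts3 m M ct) (K : ℕ) : (∑ j, |sT3 m M ct K j|) ≤ (BND3 m : ℤ) := by
  rw [Fintype.sum_sum_type, Fintype.sum_prod_type]
  simp only [Fintype.sum_prod_type]
  have h2 := inr_abs_le3 hf K
  have h0 : (∑ j : Fin 8, |sT3 m M ct K (Sum.inl j)|) = 8 * DEN := by
    simp only [sT3, Fin.sum_univ_eight, Matrix.cons_val_zero, Matrix.cons_val_one, Matrix.cons_val, abs_neg,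
      abs_of_nonneg (show (0 : ℤ) ≤ DEN from by simp [DEN])]
    ring
  simp only [sT3] at h0 ⊢
  rw [h0]
  have h4 : (8 : ℤ) ^ m = 2 ^ m * (2 ^ m * 2 ^ m) := by rw [← mul_pow, ← mul_pow]; norm_num
  have h5 : (BND3 m : ℤ) = DEN * (8 + 2 ^ m * (2 ^ m * 2 ^ m)) := by unfold BND3; push_cast; rw [h4]
  rw [h5]
  nlinarith [h2, show (0 : ℤ) ≤ DEN from by simp [DEN], show (0:ℤ) ≤ 2 ^ m * (2 ^ m * 2 ^ m) from by positivity]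

/-- **Three-sample (TC) rows are sound.** [this work] -/
theorem tc3_of_rowOK {σ M : ℕ} {ct : Tab3} {P : Set (Set (Fin m))} (hPM : ∀ x, x < 2 ^ m → (M.testBit x = true ↔ pt m x ∈ P))
    (hf : TabFacts3 m M ct) (hσ : 0 < σ) (hbnd : BND3 m * 8 ^ m < 2 ^ (σ - 1)) (q : Fin m → unitInterval) (𝒳 𝒵 : Set (Set (Fin m)))
    (hrow : rowOK (offT σ m) (offT σ m).toNat
      (tcZ3 σ m M ct (prodTab3 σ m) (krT σ m (fullN m)) (krT σ m (cpl m M)) (encA m 𝒳) (encA m 𝒵)) = true) :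
    ∑ T, sg3 m M ct q T * ind (𝒳 ∩ 𝒵) T ≤ tcR q P 𝒳 𝒵 := by
  set X := encA m 𝒳 with hX
  set Z := encA m 𝒵 with hZ
  rw [tcZ3_eq_cubicZ] at hrow
  have hB : (∑ j, |sT3 m M ct (X &&& Z) j|) * 8 ^ m < 2 ^ (σ - 1) := by
    have h1 := abs_sT3_le hf (X &&& Z)
    have h2 : (BND3 m : ℤ) * 8 ^ m < 2 ^ (σ - 1) := by exact_mod_cast hbnd
    nlinarith [h1, show (0:ℤ) < 8 ^ m from by positivity]
  have hF := cubicForm_nonneg_of_rowOK (sT3 m M ct (X &&& Z)) (v1 m M X Z) (v2 m M X Z) (v3 m M X Z) hσ hB hrow (inCube_xq q)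
  unfold cubicForm at hF
  rw [Fintype.sum_sum_type, Fintype.sum_prod_type] at hF
  simp only [Fintype.sum_prod_type, sT3, v1, v2, v3, Fin.sum_univ_eight, Matrix.cons_val_zero, Matrix.cons_val_one, Matrix.cons_val] at hF
  have hML : ∀ T' : ℕ, ML (fun g => ((tabZ m T' g : ℤ) : ℝ)) (xq q) = mlM m T' (xq q) := fun T' => rfl
  simp only [hML, show mlM m (fullN m) (xq q) = 1 from ML_fullN m (xq q)] at hF
  have hD : mlM m (cpl m M) (xq q) = pr q Pᶜ := by
    rw [pr_eq_mlM]; exact (mlM_congr (tabR_encA_eq (cpl_spec hPM)) _).symm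
  have hθ : 2 - pr q P = 1 + pr q Pᶜ := by rw [pr_compl]; ring
  have hKt : tabR m (encA m (𝒳 ∩ 𝒵)) = tabR m (X &&& Z) := by rw [hX, hZ]; exact tabR_encA_inter 𝒳 𝒵
  have hK : mlM m (X &&& Z) (xq q) = pr q (𝒳 ∩ 𝒵) := by rw [pr_eq_mlM]; exact (mlM_congr hKt _).symm
  have hXp : mlM m X (xq q) = pr q 𝒳 := by rw [pr_eq_mlM]
  have hZp : mlM m Z (xq q) = pr q 𝒵 := by rw [pr_eq_mlM]
  have hDK : mlM m (cpl m M &&& (X &&& Z)) (xq q) = pr q (Pᶜ ∩ (𝒳 ∩ 𝒵)) := by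
    rw [pr_eq_mlM]; refine mlM_congr ?_ _
    rw [(tabR_encA_inter_eq hPM (𝒳 ∩ 𝒵)).2, tabR_land m (cpl m M) (encA m (𝒳 ∩ 𝒵)), hKt, ← tabR_land]
  have hDZ : mlM m (cpl m M &&& Z) (xq q) = pr q (Pᶜ ∩ 𝒵) := by
    rw [pr_eq_mlM]; exact (mlM_congr (tabR_encA_inter_eq hPM 𝒵).2 _).symm
  have hDX : mlM m (cpl m M &&& X) (xq q) = pr q (Pᶜ ∩ 𝒳) := by
    rw [pr_eq_mlM]; exact (mlM_congr (tabR_encA_inter_eq hPM 𝒳).2 _).symm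
  have hbits : ∀ t, t < 2 ^ m → ((X &&& Z).testBit t = true ↔ (encA m (𝒳 ∩ 𝒵)).testBit t = true) := by
    intro t ht
    rw [hX, hZ, Nat.testBit_land, Bool.and_eq_true, testBit_encA, testBit_encA, testBit_encA]
    simp [ht, Set.mem_inter_iff]
  have hsg : (∑ η : Fin (2 ^ m), ∑ ζ : Fin (2 ^ m), ∑ ξ : Fin (2 ^ m),
      ((if M.testBit (η : ℕ) = false ∧ M.testBit (ζ : ℕ) = true then -massK3 m M ct (X &&& Z) η ζ ξ else 0 : ℤ) : ℝ) *
        (mlM m (2 ^ (η : ℕ)) (xq q) * mlM m (2 ^ (ζ : ℕ)) (xq q) * mlM m (2 ^ (ξ : ℕ)) (xq q))) =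
      -((DEN : ℝ) * ∑ T, sg3 m M ct q T * ind (𝒳 ∩ 𝒵) T) := by
    rw [sum_sg3_mul_ind, ← Finset.sum_neg_distrib]
    rw [Fin.sum_univ_eq_sum_range (fun η => ∑ ζ : Fin (2 ^ m), ∑ ξ : Fin (2 ^ m),
      ((if M.testBit η = false ∧ M.testBit (ζ : ℕ) = true then -massK3 m M ct (X &&& Z) η ζ ξ else 0 : ℤ) : ℝ) *
        (mlM m (2 ^ η) (xq q) * mlM m (2 ^ (ζ : ℕ)) (xq q) * mlM m (2 ^ (ξ : ℕ)) (xq q))) (2 ^ m)]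
    refine Finset.sum_congr rfl fun η hη => ?_
    rw [← Finset.sum_neg_distrib, Fin.sum_univ_eq_sum_range (fun ζ => ∑ ξ : Fin (2 ^ m),
      ((if M.testBit η = false ∧ M.testBit ζ = true then -massK3 m M ct (X &&& Z) η ζ ξ else 0 : ℤ) : ℝ) *
        (mlM m (2 ^ η) (xq q) * mlM m (2 ^ ζ) (xq q) * mlM m (2 ^ (ξ : ℕ)) (xq q))) (2 ^ m)]
    refine Finset.sum_congr rfl fun ζ hζ => ?_
    rw [← Finset.sum_neg_distrib, Fin.sum_univ_eq_sum_range (fun ξ =>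
      ((if M.testBit η = false ∧ M.testBit ζ = true then -massK3 m M ct (X &&& Z) η ζ ξ else 0 : ℤ) : ℝ) *
        (mlM m (2 ^ η) (xq q) * mlM m (2 ^ ζ) (xq q) * mlM m (2 ^ ξ) (xq q))) (2 ^ m)]
    refine Finset.sum_congr rfl fun ξ hξ => ?_
    by_cases hc : M.testBit η = false ∧ M.testBit ζ = true
    · rw [if_pos hc, if_pos hc, massK3_eq_sum' hf (X &&& Z) (Finset.mem_range.1 hη) hc.1 (Finset.mem_range.1 hζ) hc.2 (Finset.mem_range.1 hξ)]
      have : (∑ t ∈ Finset.range (2 ^ m), if (encA m (𝒳 ∩ 𝒵)).testBit t = true then (get4 ct η ζ ξ t : ℝ) else 0) =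
          ((∑ t ∈ Finset.range (2 ^ m), if (X &&& Z).testBit t = true then get4 ct η ζ ξ t else 0 : ℤ) : ℝ) := by
        push_cast
        refine Finset.sum_congr rfl fun t ht => ?_
        by_cases hb : (X &&& Z).testBit t = true
        · rw [if_pos hb, if_pos ((hbits t (Finset.mem_range.1 ht)).1 hb)]
        · rw [if_neg hb, if_neg (fun h' => hb ((hbits t (Finset.mem_range.1 ht)).2 h'))]
      rw [this]; push_cast; ring
    · rw [if_neg hc, if_neg hc]; simp
  rw [hsg, hK, hXp, hZp, hDK, hDZ, hDX, hD] at hF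
  simp only [Int.cast_natCast, Int.cast_neg] at hF
  unfold tcR
  rw [hθ]
  have hDEN := DEN_pos
  have hkey : (DEN : ℝ) * ∑ T, sg3 m M ct q T * ind (𝒳 ∩ 𝒵) T ≤ (DEN : ℝ) * ((1 + pr q Pᶜ) * (pr q (𝒳 ∩ 𝒵) - pr q 𝒳 * pr q 𝒵
      - pr q (Pᶜ ∩ (𝒳 ∩ 𝒵))) + pr q 𝒳 * pr q (Pᶜ ∩ 𝒵) + pr q 𝒵 * pr q (Pᶜ ∩ 𝒳)) := by nlinarith [hF]
  exact le_of_mul_le_mul_left hkey hDEN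

end Summit.CriticalPhenomena.PercolationContinuityZ3.Theorems.SahiTransportJR
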